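import Literature.NumberTheory.LFunctions.DworkRationalityDworkLemma
import HarnessLib

/-!
# Dwork's splitting function: coefficient estimates and overconvergence

Part of the proof of `Literature.NumberTheory.LFunctions.Dwork.dworkLifting` (plan in
`…/DworkRationalitySplitting.lean`). Following Lang, *Cyclotomic Fields I and II*, Ch. 14 §2, we
prove the estimates for Dwork's exponential `exp(x + xᵖ/p) = ∑ cₖ xᵏ` (estimate (1):
`ord cₖ ≥ -(k/p²)(2 + 1/(p-1))`) and for Dwork's power series `E_π(X) = exp(πX - πXᵖ) = ∑ eₙ Xⁿ`,
`π^{p-1} = -p` (Lemma 2.2: (i) `ord eₙ ≥ n(p-1)/p²`; (ii) `ord_π eₙ ≥ 2` for `n ≥ 2`), in the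
following form. All exponents are kept integral by using a real `b > 1` with
`b^{p²(p-1)} = p` (so `|π| = b^{-p²}`):

* `Dwork.norm_algebraMap_inv_factorial_le` — Legendre: `‖1/k!‖ ≤ b^{p²(k-1)}` (`k ≥ 1`);
* `Dwork.norm_coeff_exp_subst_le` — if `L ≡ 0 mod X^{p²}` and `‖Lⱼ‖ ≤ Bʲ` then
  `‖[Xⁿ] exp(L)‖ ≤ b^{n-p²} Bⁿ` for `n ≥ 1`, and `[Xⁿ] exp(L) = 0` for `1 ≤ n < p²`;
* `Dwork.dworkExp_eq_artinHasse_mul` — `exp(X + Xᵖ/p) = AH(X) · exp(-∑_{i≥2} X^{pⁱ}/pⁱ)`, whence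
  (`Dwork.norm_coeff_dworkExp_le_one`, `Dwork.norm_coeff_dworkExp_le`) `‖cₙ‖ ≤ 1` for `n < p²`
  and `‖cₙ‖ ≤ b^{n-p²} b^{2(p-1)n}` for `n ≥ p²` (Lang's (1));
* `Dwork.splitting_eq_rescale` — `θ_π = exp(π(X - Xᵖ)) = (exp(X + Xᵖ/p))(πX)` for `π^{p-1} = -p`,
  `Dwork.norm_pi_pow`: `|π|^{p-1} = p⁻¹`;
* `Dwork.exists_bounds_coeff_splitting` — **Lemma 2.2**: there are `0 ≤ ρ < 1` and `0 ≤ c < 1` with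
  `‖eₙ‖ ≤ ρⁿ` for all `n` (overconvergence; (i)) and `‖eₙ‖ ≤ |π|·c` for `n ≥ 2` ((ii)), together
  with `e₀ = 1`, `e₁ = π`; and `Dwork.isOverconvergent_splitting`: `θ_π ∈ R₀`.

## References

* S. Lang, *Cyclotomic Fields I and II*, GTM 121 (1990), Ch. 14 §2, estimate (1) and Lemma 2.2.
  [Lang1990]
* N. Koblitz, *p-adic Numbers, p-adic Analysis, and Zeta-Functions*, GTM 58 (1984), Ch. V §2
  (`ord_p aₙ ≥ n/(p-1)` for the equivalent `Θ = F(X, λ)`). [Koblitz1984]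
-/

open PowerSeries Finset

noncomputable section

namespace Literature.NumberTheory.LFunctions

namespace Dwork

variable {p : ℕ} [Fact p.Prime]

/-! ### The base `b = p^{1/(p²(p-1))}` and Legendre's bound -/

/-- A real `b > 1` with `b^{p²(p-1)} = p` exists (`b = p^{1/(p²(p-1))}`). [folklore] -/
theorem exists_base : ∃ b : ℝ, 1 < b ∧ b ^ (p ^ 2 * (p - 1)) = (p : ℝ) := by
  have hp : p.Prime := Fact.out
  have hN : 0 < p ^ 2 * (p - 1) := Nat.mul_pos (pow_pos hp.pos 2) (Nat.sub_pos_of_lt hp.one_lt)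
  have hp0 : (0 : ℝ) ≤ p := Nat.cast_nonneg _
  have hp1 : (1 : ℝ) < p := by exact_mod_cast hp.one_lt
  refine ⟨(p : ℝ) ^ ((1 : ℝ) / (p ^ 2 * (p - 1) : ℕ)), Real.one_lt_rpow hp1 (by positivity), ?_⟩
  rw [← Real.rpow_mul_natCast hp0, one_div_mul_cancel (by exact_mod_cast hN.ne'), Real.rpow_one]

/-- **Legendre's bound in norm form**: `‖1/k!‖_p = p^{ord_p k!} ≤ b^{p²(k-1)}` for `k ≥ 1`, because
`(p-1)·ord_p(k!) = k - s_p(k) ≤ k - 1` (Lang, Ch. 14 §2: `ord m! = (m - s(m))/(p-1)`). [cite: Lang1990, Ch. 14 §2] -/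
theorem norm_algebraMap_inv_factorial_le {b : ℝ} (hb : 1 < b) (hbp : b ^ (p ^ 2 * (p - 1)) = (p : ℝ))
    {k : ℕ} (hk : 0 < k) :
    ‖algebraMap ℚ ℚ_[p] (1 / (k.factorial : ℚ))‖ ≤ b ^ (p ^ 2 * (k - 1)) := by
  have hp : p.Prime := Fact.out
  have hfact : (k.factorial : ℚ_[p]) ≠ 0 := by exact_mod_cast k.factorial_ne_zero
  have hv : ‖(algebraMap ℚ ℚ_[p]) (1 / (k.factorial : ℚ))‖ =
      (p : ℝ) ^ (padicValNat p k.factorial : ℤ) := by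
    rw [map_div₀, map_one, map_natCast, norm_div, norm_one,
      Padic.norm_eq_zpow_neg_valuation hfact, Padic.valuation_natCast, one_div, ← zpow_neg, neg_neg]
  have hleg : (p - 1) * padicValNat p k.factorial ≤ k - 1 :=
    Nat.le_sub_one_of_lt (sub_one_mul_padicValNat_factorial_lt_of_ne_zero p hk.ne')
  rw [hv, zpow_natCast, ← hbp, ← pow_mul]
  refine pow_le_pow_right₀ hb.le ?_
  calc p ^ 2 * (p - 1) * padicValNat p k.factorial = p ^ 2 * ((p - 1) * padicValNat p k.factorial) := by
        ring
    _ ≤ p ^ 2 * (k - 1) := Nat.mul_le_mul_left _ hleg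

/-! ### Coefficients of `exp(L)` for `L ≡ 0 (mod X^{p²})` with geometrically bounded coefficients -/

/-- Powers of a series `L ≡ 0 (mod X^{m})` with `‖Lⱼ‖ ≤ Bʲ`: `Lᵏ ≡ 0 (mod X^{km})` and
`‖[Xⁿ]Lᵏ‖ ≤ Bⁿ` (ultrametric Cauchy product). [folklore] -/
theorem norm_coeff_pow_le_and_eq_zero {L : ℚ_[p]⟦X⟧} {m : ℕ} {B : ℝ} (hB : 0 ≤ B)
    (hLm : ∀ j, j < m → coeff j L = 0) (hLB : ∀ j, ‖coeff j L‖ ≤ B ^ j) (k : ℕ) :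
    ∀ n, ‖coeff n (L ^ k)‖ ≤ B ^ n ∧ (n < k * m → coeff n (L ^ k) = 0) := by
  induction k with
  | zero =>
    intro n
    rw [pow_zero, coeff_one, zero_mul]
    refine ⟨?_, fun h => absurd h (Nat.not_lt_zero n)⟩
    split_ifs with h
    · subst h; simp
    · rw [norm_zero]; exact pow_nonneg hB _
  | succ k ih =>
    intro n
    rw [pow_succ, coeff_mul]
    constructor
    · refine IsUltrametricDist.norm_sum_le_of_forall_le_of_nonneg (pow_nonneg hB _) fun ij hij => ?_
      rw [mem_antidiagonal] at hij
      rw [norm_mul, ← hij, pow_add]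
      exact mul_le_mul (ih _).1 (hLB _) (norm_nonneg _) (pow_nonneg hB _)
    · intro hn
      refine sum_eq_zero fun ij hij => ?_
      rw [mem_antidiagonal] at hij
      by_cases hi : ij.1 < k * m
      · rw [(ih _).2 hi, zero_mul]
      · have hj : ij.2 < m := by
          rw [Nat.succ_mul] at hn
          omega
        rw [hLm _ hj, mul_zero]

/-- **Coefficients of `exp(L)`** for `L ∈ X^{p²}ℚ_p⟦X⟧` with `‖Lⱼ‖ ≤ Bʲ`: for `n ≥ 1`,
`‖[Xⁿ]exp(L)‖ ≤ b^{n-p²} Bⁿ` — the term `Lᵏ/k!` vanishes unless `kp² ≤ n`, and then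
`‖1/k!‖ ≤ b^{p²(k-1)} ≤ b^{n-p²}` — and `[Xⁿ]exp(L) = 0` for `1 ≤ n < p²` (Lang, Ch. 14 §2, proof
of (2)–(3)). [cite: Lang1990, Ch. 14 §2] -/
theorem norm_coeff_exp_subst_le {b : ℝ} (hb : 1 < b) (hbp : b ^ (p ^ 2 * (p - 1)) = (p : ℝ))
    {L : ℚ_[p]⟦X⟧} {B : ℝ} (hB : 0 ≤ B) (hL : ∀ j, j < p ^ 2 → coeff j L = 0)
    (hLB : ∀ j, ‖coeff j L‖ ≤ B ^ j) {n : ℕ} (hn : 0 < n) :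
    ‖coeff n ((exp ℚ_[p]).subst L)‖ ≤ b ^ (n - p ^ 2) * B ^ n ∧
      (n < p ^ 2 → coeff n ((exp ℚ_[p]).subst L) = 0) := by
  have hp : p.Prime := Fact.out
  have hL0 : constantCoeff L = 0 := by
    rw [← coeff_zero_eq_constantCoeff_apply]; exact hL 0 (pow_pos hp.pos 2)
  have hpow := norm_coeff_pow_le_and_eq_zero hB hL hLB
  rw [coeff_exp_subst_eq_sum' hL0]
  -- each term is bounded by `b^{n-p²} Bⁿ`, and vanishes if `n < p²`
  have hterm : ∀ k ∈ range (n + 1),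
      ‖algebraMap ℚ ℚ_[p] (1 / (k.factorial : ℚ)) * coeff n (L ^ k)‖ ≤ b ^ (n - p ^ 2) * B ^ n ∧
      (n < p ^ 2 → algebraMap ℚ ℚ_[p] (1 / (k.factorial : ℚ)) * coeff n (L ^ k) = 0) := by
    intro k _
    by_cases hkn : n < k * p ^ 2
    · rw [(hpow k n).2 hkn, mul_zero, norm_zero]
      exact ⟨by positivity, fun _ => rfl⟩
    · push Not at hkn
      rcases Nat.eq_zero_or_pos k with rfl | hk
      · rw [pow_zero, coeff_one, if_neg hn.ne', mul_zero, norm_zero]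
        exact ⟨by positivity, fun _ => rfl⟩
      · refine ⟨?_, fun hlt => ?_⟩
        · rw [norm_mul]
          refine mul_le_mul ?_ (hpow k n).1 (norm_nonneg _) (by positivity)
          refine (norm_algebraMap_inv_factorial_le hb hbp hk).trans (pow_le_pow_right₀ hb.le ?_)
          have : k * p ^ 2 - p ^ 2 ≤ n - p ^ 2 := Nat.sub_le_sub_right hkn _
          calc p ^ 2 * (k - 1) = k * p ^ 2 - p ^ 2 := by
                rw [Nat.mul_sub, mul_one, mul_comm]
            _ ≤ n - p ^ 2 := this
        · exfalso
          have : p ^ 2 ≤ k * p ^ 2 := Nat.le_mul_of_pos_left _ hk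
          omega
  constructor
  · exact IsUltrametricDist.norm_sum_le_of_forall_le_of_nonneg (by positivity)
      fun k hk => (hterm k hk).1
  · intro hlt
    exact sum_eq_zero fun k hk => (hterm k hk).2 hlt

/-! ### The tail `∑_{i ≥ 2} X^{pⁱ}/pⁱ` and the factorisation of Dwork's exponential -/

/-- An elementary inequality: `p² i ≤ 2 pⁱ` for `i ≥ 2`. [folklore] -/
theorem sq_mul_le_two_mul_pow {i : ℕ} (hi : 2 ≤ i) : p ^ 2 * i ≤ 2 * p ^ i := by
  have hp : p.Prime := Fact.out
  induction i, hi using Nat.le_induction with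
  | base => rw [mul_comm]
  | succ i hi ih =>
    have h1 : p ^ 2 ≤ p ^ i := Nat.pow_le_pow_right hp.pos hi
    have h2 : 2 ≤ p := hp.two_le
    calc p ^ 2 * (i + 1) = p ^ 2 * i + p ^ 2 := by ring
      _ ≤ 2 * p ^ i + p ^ i := add_le_add ih h1
      _ ≤ 2 * p ^ i + p ^ i + p ^ i := Nat.le_add_right _ _
      _ = 2 * (2 * p ^ i) := by ring
      _ ≤ 2 * (p * p ^ i) := Nat.mul_le_mul_left 2 (Nat.mul_le_mul_right _ h2)
      _ = 2 * p ^ (i + 1) := by rw [pow_succ']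

/-- The coefficients of the tail `ahLog - X - Xᵖ/p = ∑_{i ≥ 2} X^{pⁱ}/pⁱ`: zero below degree `p²`.
[cite: Lang1990, Ch. 14 §2] -/
theorem coeff_ahTail_eq_zero {j : ℕ} (hj : j < p ^ 2) :
    coeff j (ahLog p - X - C ((p : ℚ_[p])⁻¹) * X ^ p) = 0 := by
  have hp : p.Prime := Fact.out
  rw [map_sub, map_sub, coeff_ahLog, coeff_X, coeff_C_mul_X_pow]
  by_cases h1 : j = 1
  · subst h1
    rw [if_pos ⟨0, (pow_zero p).symm⟩, if_pos rfl, if_neg hp.one_lt.ne, Nat.cast_one, inv_one,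
      sub_self, sub_zero]
  by_cases h2 : j = p
  · subst h2
    rw [if_pos ⟨1, (pow_one j).symm⟩, if_neg h1, if_pos rfl, sub_zero, sub_self]
  rw [if_neg h1, if_neg h2, sub_zero, sub_zero, if_neg]
  rintro ⟨i, rfl⟩
  rcases i with _ | _ | i
  · exact h1 (pow_zero p)
  · exact h2 (pow_one p)
  · exact absurd hj (not_lt.mpr (Nat.pow_le_pow_right hp.pos (by omega)))

/-- The coefficients of the tail are bounded by `(b^{2(p-1)})ʲ`: the coefficient of `X^{pⁱ}`,
`i ≥ 2`, has norm `pⁱ = b^{p²(p-1)i} ≤ b^{2(p-1)pⁱ}` (Lang, Ch. 14 §2, (2): `ord d_k ≥ -(k/pⁿ)(n + …)`,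
minimised at `n = 2`). [cite: Lang1990, Ch. 14 §2] -/
theorem norm_coeff_ahTail_le {b : ℝ} (hb : 1 < b) (hbp : b ^ (p ^ 2 * (p - 1)) = (p : ℝ)) (j : ℕ) :
    ‖coeff j (ahLog p - X - C ((p : ℚ_[p])⁻¹) * X ^ p)‖ ≤ (b ^ (2 * (p - 1))) ^ j := by
  have hp : p.Prime := Fact.out
  by_cases hj : j < p ^ 2
  · rw [coeff_ahTail_eq_zero hj, norm_zero]; positivity
  -- `j ≥ p²`: the only nonzero coefficients are at `j = pⁱ`, `i ≥ 2`
  rw [map_sub, map_sub, coeff_ahLog, coeff_X, coeff_C_mul_X_pow,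
    if_neg (show j ≠ 1 by intro h; subst h; exact hj (Nat.one_lt_pow two_ne_zero hp.one_lt)),
    if_neg (show j ≠ p by intro h; subst h; exact hj (by nlinarith [hp.two_le])), sub_zero, sub_zero]
  split_ifs with hpow
  · obtain ⟨i, rfl⟩ := hpow
    have hi : 2 ≤ i := by
      by_contra h
      exact hj (Nat.pow_lt_pow_right hp.one_lt (by omega))
    rw [norm_inv, Nat.cast_pow, norm_pow, Padic.norm_p, inv_pow, inv_inv, ← hbp, ← pow_mul, ← pow_mul]
    refine pow_le_pow_right₀ hb.le ?_
    calc p ^ 2 * (p - 1) * i = (p - 1) * (p ^ 2 * i) := by ring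
      _ ≤ (p - 1) * (2 * p ^ i) := Nat.mul_le_mul_left _ (sq_mul_le_two_mul_pow hi)
      _ = 2 * (p - 1) * p ^ i := by ring
  · rw [norm_zero]; positivity

/-- **Factorisation of Dwork's exponential**: `exp(X + Xᵖ/p) = AH(X) · exp(-∑_{i ≥ 2} X^{pⁱ}/pⁱ)`
(Lang, *Cyclotomic Fields I and II*, Ch. 14 §2, proof of (1)). [cite: Lang1990, Ch. 14 §2] -/
theorem dworkExp_eq_artinHasse_mul :
    dworkExp p = artinHasse p * (exp ℚ_[p]).subst (-(ahLog p - X - C ((p : ℚ_[p])⁻¹) * X ^ p)) := by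
  have hp : p.Prime := Fact.out
  have hT : constantCoeff (-(ahLog p - X - C ((p : ℚ_[p])⁻¹) * X ^ p)) = 0 := by
    rw [map_neg, ← coeff_zero_eq_constantCoeff_apply, coeff_ahTail_eq_zero (pow_pos hp.pos 2),
      neg_zero]
  rw [dworkExp, artinHasse, ← Literature.AlgebraicGeometry.Motives.FrobeniusTrace.exp_subst_add
    constantCoeff_ahLog hT]
  congr 1
  ring

/-- Coefficients of the correction factor `exp(-∑_{i ≥ 2} X^{pⁱ}/pⁱ) = ∑ dₙ Xⁿ`: `d₀ = 1`,
`dₙ = 0` for `1 ≤ n < p²`, and `‖dₙ‖ ≤ b^{n-p²} b^{2(p-1)n}` for `n ≥ 1` (Lang, Ch. 14 §2, (3)). [cite: Lang1990, Ch. 14 §2] -/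
theorem norm_coeff_exp_neg_ahTail_le {b : ℝ} (hb : 1 < b) (hbp : b ^ (p ^ 2 * (p - 1)) = (p : ℝ))
    {n : ℕ} (hn : 0 < n) :
    ‖coeff n ((exp ℚ_[p]).subst (-(ahLog p - X - C ((p : ℚ_[p])⁻¹) * X ^ p)))‖ ≤
        b ^ (n - p ^ 2) * (b ^ (2 * (p - 1))) ^ n ∧
      (n < p ^ 2 → coeff n ((exp ℚ_[p]).subst (-(ahLog p - X - C ((p : ℚ_[p])⁻¹) * X ^ p))) = 0) :=
  norm_coeff_exp_subst_le hb hbp (by positivity)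
    (fun j hj => by rw [map_neg, coeff_ahTail_eq_zero hj, neg_zero])
    (fun j => by rw [map_neg, norm_neg]; exact norm_coeff_ahTail_le hb hbp j) hn

/-- **Lang's estimate (1), small degrees**: for `n < p²` the coefficient `cₙ` of `exp(X + Xᵖ/p)`
equals the Artin–Hasse coefficient, hence `‖cₙ‖ ≤ 1`. [cite: Lang1990, Ch. 14 §2] -/
theorem norm_coeff_dworkExp_le_one {b : ℝ} (hb : 1 < b) (hbp : b ^ (p ^ 2 * (p - 1)) = (p : ℝ))
    {n : ℕ} (hn : n < p ^ 2) : ‖coeff n (dworkExp p)‖ ≤ 1 := by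
  have hp : p.Prime := Fact.out
  have hT : constantCoeff (-(ahLog p - X - C ((p : ℚ_[p])⁻¹) * X ^ p)) = 0 := by
    rw [map_neg, ← coeff_zero_eq_constantCoeff_apply, coeff_ahTail_eq_zero (pow_pos hp.pos 2),
      neg_zero]
  rw [dworkExp_eq_artinHasse_mul, coeff_mul]
  refine IsUltrametricDist.norm_sum_le_of_forall_le_of_nonneg zero_le_one fun ij hij => ?_
  rw [mem_antidiagonal] at hij
  rw [norm_mul]
  rcases Nat.eq_zero_or_pos ij.2 with h0 | hpos
  · rw [h0, coeff_zero_eq_constantCoeff_apply,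
      Literature.AlgebraicGeometry.Motives.FrobeniusTrace.constantCoeff_exp_subst hT, norm_one, mul_one]
    exact norm_coeff_artinHasse_le_one _
  · rw [(norm_coeff_exp_neg_ahTail_le hb hbp hpos).2 (by omega), norm_zero, mul_zero]
    exact zero_le_one

/-- **Lang's estimate (1)**: `‖cₙ‖ ≤ b^{n-p²} · b^{2(p-1)n}` for the coefficients of `exp(X + Xᵖ/p)`
and `n ≥ p²` (i.e. `ord_p cₙ ≥ -(n/p²)(2 + 1/(p-1)) + 1/(p-1)`; Lang, *Cyclotomic Fields I and II*,
Ch. 14 §2, (1), with the gain `1/(p-1)` from `ord k! ≤ (k-1)/(p-1)` kept). [cite: Lang1990, Ch. 14 §2 (1)] -/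
theorem norm_coeff_dworkExp_le {b : ℝ} (hb : 1 < b) (hbp : b ^ (p ^ 2 * (p - 1)) = (p : ℝ))
    {n : ℕ} (hn : p ^ 2 ≤ n) : ‖coeff n (dworkExp p)‖ ≤ b ^ (n - p ^ 2) * (b ^ (2 * (p - 1))) ^ n := by
  have hp : p.Prime := Fact.out
  have hn0 : 0 < n := lt_of_lt_of_le (pow_pos hp.pos 2) hn
  have hb1 : 1 ≤ b := hb.le
  have hB1 : 1 ≤ b ^ (2 * (p - 1)) := one_le_pow₀ hb1
  have hT : constantCoeff (-(ahLog p - X - C ((p : ℚ_[p])⁻¹) * X ^ p)) = 0 := by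
    rw [map_neg, ← coeff_zero_eq_constantCoeff_apply, coeff_ahTail_eq_zero (pow_pos hp.pos 2),
      neg_zero]
  rw [dworkExp_eq_artinHasse_mul, coeff_mul]
  refine IsUltrametricDist.norm_sum_le_of_forall_le_of_nonneg (by positivity) fun ij hij => ?_
  rw [mem_antidiagonal] at hij
  rw [norm_mul]
  refine (mul_le_of_le_one_left (norm_nonneg _) (norm_coeff_artinHasse_le_one _)).trans ?_
  rcases Nat.eq_zero_or_pos ij.2 with h0 | hpos
  · rw [h0, coeff_zero_eq_constantCoeff_apply,
      Literature.AlgebraicGeometry.Motives.FrobeniusTrace.constantCoeff_exp_subst hT, norm_one]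
    exact one_le_mul_of_one_le_of_one_le (one_le_pow₀ hb1) (one_le_pow₀ hB1)
  · refine (norm_coeff_exp_neg_ahTail_le hb hbp hpos).1.trans ?_
    exact mul_le_mul (pow_le_pow_right₀ hb1 (Nat.sub_le_sub_right (by omega) _))
      (pow_le_pow_right₀ hB1 (by omega)) (by positivity) (by positivity)

/-- The constant coefficient of Dwork's exponential is `1`. [folklore] -/
theorem constantCoeff_dworkExp : constantCoeff (dworkExp p) = 1 :=
  Literature.AlgebraicGeometry.Motives.FrobeniusTrace.constantCoeff_exp_subst constantCoeff_dworkExp_arg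

/-- The linear coefficient of Dwork's exponential is `1`. [folklore] -/
theorem coeff_one_dworkExp : coeff 1 (dworkExp p) = 1 := by
  have hp : p.Prime := Fact.out
  rw [dworkExp, coeff_exp_subst_eq_sum' constantCoeff_dworkExp_arg, sum_range_succ,
    sum_range_succ, sum_range_zero, zero_add, pow_zero, pow_one, coeff_one, if_neg one_ne_zero,
    mul_zero, zero_add, map_add, coeff_X, if_pos rfl, coeff_C_mul_X_pow, if_neg hp.one_lt.ne,
    add_zero, Nat.factorial_one, Nat.cast_one, div_one, map_one, one_mul]

/-! ### Dwork's power series `E_π = θ_π` over `ℂ_p` -/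

/-- The embedding `ℚ_p → ℂ_p` is an isometry. [folklore] -/
theorem norm_algebraMap_padicComplex (x : ℚ_[p]) : ‖algebraMap ℚ_[p] ℂ_[p] x‖ = ‖x‖ := by
  rw [IsScalarTower.algebraMap_apply ℚ_[p] (PadicAlgCl p) ℂ_[p], ← PadicComplex.coe_eq]
  exact PadicComplex.norm_extends' p x

/-- `‖p‖ = p⁻¹` in `ℂ_p`. [folklore] -/
theorem norm_natCast_p_padicComplex : ‖(p : ℂ_[p])‖ = (p : ℝ)⁻¹ := by
  rw [← map_natCast (algebraMap ℚ_[p] ℂ_[p]) p, norm_algebraMap_padicComplex, Padic.norm_p]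

/-- For `π^{p-1} = -p`: `|π|^{p-1} = p⁻¹` (Lang, Ch. 14 §2: `ord eₙ ∈ (1/(p-1))ℤ`, `ord π = 1/(p-1)`). [cite: Lang1990, Ch. 14 §2] -/
theorem norm_pi_pow {π : ℂ_[p]} (hπ : π ^ (p - 1) = -p) : ‖π‖ ^ (p - 1) = (p : ℝ)⁻¹ := by
  rw [← norm_pow, hπ, norm_neg, norm_natCast_p_padicComplex]

/-- For `π^{p-1} = -p` and `b^{p²(p-1)} = p`: `|π| · b^{p²} = 1`. [folklore] -/
theorem norm_pi_mul_pow_eq_one {π : ℂ_[p]} (hπ : π ^ (p - 1) = -p) {b : ℝ} (hb : 1 < b)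
    (hbp : b ^ (p ^ 2 * (p - 1)) = (p : ℝ)) : ‖π‖ * b ^ (p ^ 2) = 1 := by
  have hp : p.Prime := Fact.out
  have hp0 : (p : ℝ) ≠ 0 := by exact_mod_cast hp.ne_zero
  have h : (‖π‖ * b ^ (p ^ 2)) ^ (p - 1) = 1 := by
    rw [mul_pow, norm_pi_pow hπ, ← pow_mul, hbp, inv_mul_cancel₀ hp0]
  exact (pow_eq_one_iff_of_nonneg (by positivity) (Nat.sub_ne_zero_of_lt hp.one_lt)).mp h

/-- `π ≠ 0` and `|π| < 1` for `π^{p-1} = -p`. [folklore] -/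
theorem norm_pi_lt_one {π : ℂ_[p]} (hπ : π ^ (p - 1) = -p) : ‖π‖ < 1 := by
  have hp : p.Prime := Fact.out
  have h := norm_pi_pow hπ
  by_contra hge
  push Not at hge
  have : (1 : ℝ) ≤ ‖π‖ ^ (p - 1) := one_le_pow₀ hge
  rw [h] at this
  have hp1 : (1 : ℝ) < p := by exact_mod_cast hp.one_lt
  exact absurd this (not_le.mpr (inv_lt_one_of_one_lt₀ hp1))

/-- `π ≠ 0` for `π^{p-1} = -p`. [folklore] -/
theorem pi_ne_zero {π : ℂ_[p]} (hπ : π ^ (p - 1) = -p) : π ≠ 0 := by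
  have hp : p.Prime := Fact.out
  rintro rfl
  rw [zero_pow (Nat.sub_ne_zero_of_lt hp.one_lt), eq_comm, neg_eq_zero] at hπ
  exact hp.ne_zero (by exact_mod_cast hπ)

/-- **`θ_π = (exp(X + Xᵖ/p))(πX)`**: for `π^{p-1} = -p` one has `πᵖ/p = -π`, so
`exp(πX - πXᵖ) = exp(πX + (πX)ᵖ/p)` (Lang, *Cyclotomic Fields I and II*, Ch. 14 §2, the display
after the definition of `E_π`). [cite: Lang1990, Ch. 14 §2] -/
theorem splitting_eq_rescale {π : ℂ_[p]} (hπ : π ^ (p - 1) = -p) :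
    splitting p π = rescale π (PowerSeries.map (algebraMap ℚ_[p] ℂ_[p]) (dworkExp p)) := by
  have hp : p.Prime := Fact.out
  have hp0 : (p : ℂ_[p]) ≠ 0 := by exact_mod_cast hp.ne_zero
  have hπp : π ^ p = -p * π := by
    have h : π ^ (p - 1 + 1) = -p * π := by rw [pow_succ, hπ]
    rwa [Nat.sub_add_cancel hp.one_le] at h
  have hφ : ∀ x : ℚ, (algebraMap ℚ_[p] ℂ_[p]) (algebraMap ℚ ℚ_[p] x) = algebraMap ℚ ℂ_[p] x := by
    intro x; rw [eq_ratCast (algebraMap ℚ ℚ_[p]), map_ratCast, eq_ratCast]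
  rw [dworkExp, map_exp_subst _ hφ constantCoeff_dworkExp_arg, rescale_exp_subst, splitting]
  · congr 1
    ext n
    rw [coeff_rescale]
    simp only [coeff_C_mul, map_sub, map_add, map_mul, map_pow, map_X, map_C,
      map_inv₀, map_natCast, coeff_X, coeff_X_pow]
    by_cases h1 : n = 1
    · subst h1
      rw [if_pos rfl, if_neg hp.one_lt.ne]
      ring
    · rw [if_neg h1]
      by_cases h2 : n = p
      · subst h2
        rw [if_pos rfl, hπp]
        field_simp
        ring
      · rw [if_neg h2]
        ring
  · rw [← coeff_zero_eq_constantCoeff_apply, coeff_map, coeff_zero_eq_constantCoeff_apply,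
      constantCoeff_dworkExp_arg, map_zero]

/-- The coefficients of `θ_π`: `eₙ = πⁿ cₙ`. [cite: Lang1990, Ch. 14 §2] -/
theorem coeff_splitting {π : ℂ_[p]} (hπ : π ^ (p - 1) = -p) (n : ℕ) :
    coeff n (splitting p π) = π ^ n * algebraMap ℚ_[p] ℂ_[p] (coeff n (dworkExp p)) := by
  rw [splitting_eq_rescale hπ, coeff_rescale, coeff_map]

/-- `‖eₙ‖ = |π|ⁿ ‖cₙ‖`. [cite: Lang1990, Ch. 14 §2] -/
theorem norm_coeff_splitting {π : ℂ_[p]} (hπ : π ^ (p - 1) = -p) (n : ℕ) :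
    ‖coeff n (splitting p π)‖ = ‖π‖ ^ n * ‖coeff n (dworkExp p)‖ := by
  rw [coeff_splitting hπ, norm_mul, norm_pow, norm_algebraMap_padicComplex]

/-- `θ_π(0) = 1`. [folklore] -/
theorem constantCoeff_splitting (π : ℂ_[p]) : constantCoeff (splitting p π) = 1 :=
  Literature.AlgebraicGeometry.Motives.FrobeniusTrace.constantCoeff_exp_subst
    (constantCoeff_splitting_arg π)

/-- `e₁ = π`: `θ_π = 1 + πX + ⋯`. [cite: Lang1990, Ch. 14 §2] -/
theorem coeff_one_splitting {π : ℂ_[p]} (hπ : π ^ (p - 1) = -p) : coeff 1 (splitting p π) = π := by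
  rw [coeff_splitting hπ, coeff_one_dworkExp, map_one, mul_one, pow_one]

/-- **Lang's Lemma 2.2 for Dwork's power series `E_π = ∑ eₙ Xⁿ`**, `π^{p-1} = -p`, in norm form:
there are `0 ≤ ρ < 1` and `0 ≤ c < 1` with (i) `‖eₙ‖ ≤ ρⁿ` for all `n` (from
`ord eₙ ≥ n(p-1)/p²`; this is overconvergence, radius of convergence `> 1`) and
(ii) `‖eₙ‖ ≤ |π|·c < |π|` for `n ≥ 2` (`ord_π eₙ ≥ 2`). Here `ρ = max |π| (|π| b^{2p-1})` and for
`n ≥ p²`, `‖eₙ‖ ≤ (|π| b^{2p-1})ⁿ |π|` with `|π| b^{2p-1} = b^{-(p-1)²} < 1`; for `2 ≤ n < p²`,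
`‖eₙ‖ ≤ |π|ⁿ ≤ |π|²`. (Lang checks the cases `p ≤ 3`, `n ≤ 4` by hand; the bound with the gain
`ord k! ≤ (k-1)/(p-1)` covers them uniformly.) [cite: Lang1990, Ch. 14 §2 Lemma 2.2] -/
theorem exists_bounds_coeff_splitting {π : ℂ_[p]} (hπ : π ^ (p - 1) = -p) :
    ∃ ρ c : ℝ, 0 ≤ ρ ∧ ρ < 1 ∧ 0 ≤ c ∧ c < 1 ∧ (∀ n, ‖coeff n (splitting p π)‖ ≤ ρ ^ n) ∧
      ∀ n, 2 ≤ n → ‖coeff n (splitting p π)‖ ≤ ‖π‖ * c := by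
  have hp : p.Prime := Fact.out
  obtain ⟨b, hb, hbp⟩ := exists_base (p := p)
  have hπ1 := norm_pi_mul_pow_eq_one hπ hb hbp
  have hπlt := norm_pi_lt_one hπ
  have hπ0 : 0 ≤ ‖π‖ := norm_nonneg _
  set r : ℝ := ‖π‖ * b ^ (2 * p - 1) with hr
  have hr0 : 0 ≤ r := by positivity
  -- `r · b^{(p-1)²} = |π| b^{p²} = 1`, so `r < 1`
  have hr1 : r < 1 := by
    have hsq : 2 * p - 1 + (p - 1) ^ 2 = p ^ 2 := by
      have h2 : 2 ≤ p := hp.two_le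
      zify [h2, Nat.one_le_two_pow, show 1 ≤ 2 * p by omega, show 1 ≤ p by omega]
      ring
    have h : r * b ^ ((p - 1) ^ 2) = 1 := by
      rw [hr, mul_assoc, ← pow_add, hsq, hπ1]
    have hbgt : 1 < b ^ ((p - 1) ^ 2) :=
      one_lt_pow₀ hb (pow_ne_zero 2 (Nat.sub_ne_zero_of_lt hp.one_lt))
    by_contra hge
    push Not at hge
    have : 1 * b ^ ((p - 1) ^ 2) ≤ r * b ^ ((p - 1) ^ 2) := by gcongr
    rw [h, one_mul] at this
    exact absurd this (not_le.mpr hbgt)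
  -- the two regimes
  have hsmall : ∀ n, n < p ^ 2 → ‖coeff n (splitting p π)‖ ≤ ‖π‖ ^ n := fun n hn => by
    rw [norm_coeff_splitting hπ]
    exact mul_le_of_le_one_right (pow_nonneg hπ0 _) (norm_coeff_dworkExp_le_one hb hbp hn)
  have hlarge : ∀ n, p ^ 2 ≤ n → ‖coeff n (splitting p π)‖ ≤ r ^ n * ‖π‖ := fun n hn => by
    rw [norm_coeff_splitting hπ]
    refine (mul_le_mul_of_nonneg_left (norm_coeff_dworkExp_le hb hbp hn) (pow_nonneg hπ0 _)).trans
      (le_of_eq ?_)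
    -- `|π|ⁿ b^{n-p²} B^n = rⁿ |π|` using `|π| b^{p²} = 1`
    have h1 : b ^ (n - p ^ 2) = b ^ n * ‖π‖ := by
      have := pow_sub_mul_pow b hn
      calc b ^ (n - p ^ 2) = b ^ (n - p ^ 2) * (‖π‖ * b ^ (p ^ 2)) := by rw [hπ1, mul_one]
        _ = b ^ (n - p ^ 2) * b ^ (p ^ 2) * ‖π‖ := by ring
        _ = b ^ n * ‖π‖ := by rw [this]
    have h2 : 2 * p - 1 = 1 + 2 * (p - 1) := by have := hp.two_le; omega
    rw [h1, hr, h2, mul_pow, pow_add, pow_one, ← pow_mul, mul_pow]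
    ring
  refine ⟨max ‖π‖ r, max ‖π‖ (r ^ 2), le_max_of_le_left hπ0, max_lt hπlt hr1,
    le_max_of_le_left hπ0, max_lt hπlt (pow_lt_one₀ hr0 hr1 two_ne_zero), fun n => ?_,
    fun n hn => ?_⟩
  · rcases lt_or_ge n (p ^ 2) with h | h
    · exact (hsmall n h).trans (pow_le_pow_left₀ hπ0 (le_max_left _ _) n)
    · refine (hlarge n h).trans ?_
      calc r ^ n * ‖π‖ ≤ r ^ n * 1 := mul_le_mul_of_nonneg_left hπlt.le (pow_nonneg hr0 _)
        _ ≤ (max ‖π‖ r) ^ n := by rw [mul_one]; exact pow_le_pow_left₀ hr0 (le_max_right _ _) n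
  · rcases lt_or_ge n (p ^ 2) with h | h
    · refine (hsmall n h).trans ?_
      calc ‖π‖ ^ n ≤ ‖π‖ ^ 2 := pow_le_pow_of_le_one hπ0 hπlt.le hn
        _ = ‖π‖ * ‖π‖ := sq _
        _ ≤ ‖π‖ * max ‖π‖ (r ^ 2) := mul_le_mul_of_nonneg_left (le_max_left _ _) hπ0
    · refine (hlarge n h).trans ?_
      rw [mul_comm]
      refine mul_le_mul_of_nonneg_left ?_ hπ0
      have h4 : 2 ≤ n := le_trans (by nlinarith [hp.two_le]) h
      exact (pow_le_pow_of_le_one hr0 hr1.le h4).trans (le_max_right _ _)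

/-- **Dwork's power series is overconvergent**: `θ_π ∈ R₀ ⊆ ℂ_p⟦X⟧` (as a series in one variable,
`ℂ_p⟦X⟧ = MvPowerSeries Unit ℂ_p`), i.e. `‖eₙ‖ ≤ ρⁿ` with `ρ < 1` (Lang, Ch. 14 §2, Lemma 2.2 (i)
and the Remark after it; Koblitz, Ch. V §2, `Θ(T)` converges on `D(p^{1/(p-1)⁻})`). [cite: Lang1990, Ch. 14 §2 Lemma 2.2] -/
theorem isOverconvergent_splitting {π : ℂ_[p]} (hπ : π ^ (p - 1) = -p) :
    IsOverconvergent p (splitting p π) := by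
  obtain ⟨ρ, c, hρ0, hρ1, -, -, hρ, -⟩ := exists_bounds_coeff_splitting hπ
  refine ⟨ρ, hρ0, hρ1, fun w => ?_⟩
  rw [Finsupp.unique_single w, Finsupp.degree_single]
  exact hρ (w ())

end Dwork

end Literature.NumberTheory.LFunctions
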